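import Literature.NumberTheory.Automorphic.SymplecticSimilitudeSatakeIsomorphism
import Literature.NumberTheory.Automorphic.SymplecticSphericalCharacters
import HarnessLib

/-!
# The spherical characters of `GSp_{2n}`: every character of `ℋ_k(GSp_{2n}(K), GSp_{2n}(𝒪))` is an unramified eigencharacter
# `λ_χ = ev_χ ∘ 𝒮_q`, and `λ_χ = λ_{χ'}` iff `χ' ∈ W(GSp_{2n}) · χ` (Andrianov–Zhuravlev Prop. 3.36 and Problem 3.41;
# Cartier 1979 §IV Cor. 4.2 for `GSp_{2n}`, every rank, every algebraically closed field with `q` a unit)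

Topic `NumberTheory/Automorphic`; namespace `Literature.NumberTheory.Automorphic.SymplecticCartan` (lane `lit-hodgefound`,
Track 2 foundations; seat `lit-hodgefound-p11`, generation 51, row g51-#5).  DEFINITIONS with bodies (`similitudeSignedPermSubgroup`,
`similitudeWeylGroupAlgAut`, `similitudeWeylGroupAction`, `similitudeEvalChar`) + theorems; no named fact, no instance (the `W`-action on
`k[ℤⁿ × ℤ]` is a `def`, used through `letI`), no notation.  The `GSp_{2n}` twin of `SymplecticSphericalCharacters` (g50-#7), on top of
the Satake isomorphism `similitudeSatakeAlgEquiv : ℋ_k ⥲ k[ℤⁿ × ℤ]^{W(GSp_{2n})}` (g51-#4) and the tree's commutative algebra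
`FixedPointSubalgebraCharacters` (g48-#8: characters extend from invariants of a finite group; transitivity on the fibres).

## The mathematics

`G = GSp_{2n}(K)`, `K₀ = GSp_{2n}(𝒪)`, `W = W(GSp_{2n}) = {(ε, π)}` acting on `Λ = ℤⁿ × ℤ` and on `B = k[Λ]` (`x^λ ↦ x^{wλ}`),
`A = B^W = 𝒮_q(ℋ_k)`.  For a character `χ : Λ → k` (`χ(μ, c) = β₀^c ∏ βᵢ^{μᵢ}`, `(β₀; β) ∈ kˣ × (kˣ)ⁿ` — Andrianov–Zhuravlev's
parameters `A = (α_0, α_1, …, α_n)`, `x_i ↦ α_i`) the unramified eigencharacter is `λ_χ = ev_χ ∘ 𝒮_q : ℋ_k → k`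
(`similitudeHeckeEigencharacter`).  [AndrianovZhuravlev1995] Prop. 3.36: «every nonzero ℚ-linear homomorphism `λ` from `L^n_p` to
`ℂ` has the form `λ_A`»; Problem 3.41: «`λ_A = λ_{A'}` if and only if `A' = wA` for some `w ∈ W_n`»; [CartierCorvallis1979] §IV
Cor. 4.2.  EXISTENCE: a character `ψ` of `ℋ_k` is, through `𝒮_q`, a character of `A = B^W`; `W` is finite, so it extends to a
character `Ψ = ev_χ` of `B` (integrality of `B` over `B^W`), and `ψ = λ_χ`.  UNIQUENESS: if `λ_χ = λ_{χ'}` then `ker ev_χ`,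
`ker ev_{χ'}` are maximal ideals of `B` over the same maximal ideal of `A`, hence conjugate under `W` ([BourbakiAC5to7] V §2 no. 2
Thm. 2; Mathlib's `Algebra.IsInvariant.exists_smul_of_under_eq`), so `ev_{χ'} = ev_χ ∘ g⁻¹` and `χ' = χ ∘ w`.  Conversely `χ' = χ ∘ w`
gives `λ_{χ'} = λ_χ` by the `W`-invariance of `𝒮_q(T)` (g51-#2).  Consequently
**`Hom_{k-alg}(ℋ_k(GSp_{2n}(K), GSp_{2n}(𝒪)), k) ≅ Hom(ℤⁿ × ℤ, kˣ)/W(GSp_{2n}) = (kˣ × (kˣ)ⁿ)/W`**, the unramified `L`-parameters of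
`GSp_{2n}` (semisimple classes in `GSpin_{2n+1}(k)`).

## What is formalised

* §1 **`similitudeSignedPermEquiv_mul`/`_one`/`_inv`**, `similitudeSignedPermSubgroup`, **`mem_similitudeWeylGroup_iff`**
  (`W(GSp_{2n}) = {similitudeSignedPermEquiv ε π}`), **`finite_similitudeWeylGroup`**.
* §2 **`similitudeWeylGroupAlgAut`**, **`similitudeWeylGroupAction`** (`MulSemiringAction`, a def), `similitudeWeylGroupAction_smul`,
  **`forall_smul_eq_self_iff_mem_weylInvariants_similitude`**.
* §3 **`similitudeEvalChar χ = ev_χ`**, `similitudeEvalChar_single`, `similitudeEvalChar_smul_single_one`,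
  **`map_ofAdd_eq_coe_prod_toHomUnits_similitude`** (`χ(μ, c) = β₀^c ∏ βᵢ^{μᵢ}`), `similitudeHeckeEigencharacter_apply_eq_similitudeEvalChar`.
* §4 **`exists_eq_similitudeHeckeEigencharacter`** (EXISTENCE, A–Z Prop. 3.36), `exists_eq_similitudeHeckeEigencharacter_point`.
* §5 **`similitudeHeckeEigencharacter_eq_of_exists_signedPerm`** (⇐, any commutative `k`),
  **`exists_signedPerm_of_similitudeHeckeEigencharacter_eq`** (⇒), **`similitudeHeckeEigencharacter_eq_iff_exists_signedPerm`**
  (A–Z Problem 3.41: UNIQUENESS UP TO `W(GSp_{2n})`).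

## References
* [AndrianovZhuravlev1995] A. N. Andrianov, V. G. Zhuravlev, *Modular Forms and Hecke Operators*, Transl. Math. Monogr. 145
  (1995), Ch. 3 §3.3 (3.51), Thm. 3.30, Prop. 3.36, Problem 3.41.
* [CartierCorvallis1979] P. Cartier, *Representations of 𝔭-adic groups: a survey*, PSPM 33.1 (1979), §IV Cor. 4.2 and its proof.
* [Satake1963] I. Satake, *Theory of spherical functions on reductive algebraic groups over 𝔭-adic fields*, Publ. Math. IHÉS 18
  (1963), §6 Thm. 7, §7.
* [BourbakiAC5to7] N. Bourbaki, *Algèbre commutative*, Ch. V §1 no. 9 Prop. 22, §2 no. 2 Thm. 2.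
* [GrossSatake1998] B. H. Gross, *On the Satake isomorphism* (1998), §§3, 6 (unramified parameters).
-/

noncomputable section

open scoped Valued WithZero MatrixGroups Pointwise
open Matrix MonoidAlgebra Representation

namespace Literature.NumberTheory.Automorphic.SymplecticCartan

open Literature.NumberTheory.Automorphic Literature.NumberTheory.Automorphic.CartanUnique
  Literature.NumberTheory.Automorphic.HermitianLattice

variable {n : ℕ}

/-! ## §1 `W(GSp_{2n})` is the finite group `{(ε, π)}` -/

/-- Composition of the `if`-branches of two Weyl elements. [cite: AndrianovZhuravlev1995, Ch. 3 §3.3 (3.51)] -/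
private theorem ite_units_comp (u v : ℤˣ) (x c : ℤ) :
    (if u = 1 then (if v = 1 then x else c - x) else c - (if v = 1 then x else c - x)) = if u * v = 1 then x else c - x := by
  rcases Int.units_eq_one_or u with rfl | rfl <;> rcases Int.units_eq_one_or v with rfl | rfl <;> simp

/-- **Composition in `W(GSp_{2n})`**: `(ε, π) ∘ (ε', π') = ((ε_i ε'_{π i})_i, π' π)` (the same law as for the signed permutations
of `Sp_{2n}`). [cite: AndrianovZhuravlev1995, Ch. 3 §3.3 (3.51)] [cite: Satake1963, §7] -/
theorem similitudeSignedPermEquiv_mul (ε ε' : Fin n → ℤˣ) (π π' : Equiv.Perm (Fin n)) :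
    similitudeSignedPermEquiv ε π * similitudeSignedPermEquiv ε' π' =
      similitudeSignedPermEquiv (fun i => ε i * ε' (π i)) (π' * π) := by
  refine LinearEquiv.ext fun μc => ?_
  rw [LinearEquiv.mul_apply, similitudeSignedPermEquiv_apply, similitudeSignedPermEquiv_apply, similitudeSignedPermEquiv_apply]
  refine Prod.ext (funext fun i => ?_) rfl
  dsimp only
  rw [ite_units_comp, Equiv.Perm.mul_apply]

/-- The trivial element is the identity. [cite: AndrianovZhuravlev1995, Ch. 3 §3.3 (3.51)] -/
theorem similitudeSignedPermEquiv_one : similitudeSignedPermEquiv (fun _ : Fin n => (1 : ℤˣ)) 1 = 1 := by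
  refine LinearEquiv.ext fun μc => ?_
  rw [similitudeSignedPermEquiv_apply]
  refine Prod.ext (funext fun i => ?_) rfl
  dsimp only
  rw [if_pos rfl, Equiv.Perm.one_apply]
  rfl

/-- **Inverse in `W(GSp_{2n})`**: `(ε, π)⁻¹ = ((ε_{π⁻¹ j})_j, π⁻¹)`. [cite: AndrianovZhuravlev1995, Ch. 3 §3.3 (3.51)] -/
theorem similitudeSignedPermEquiv_inv (ε : Fin n → ℤˣ) (π : Equiv.Perm (Fin n)) :
    (similitudeSignedPermEquiv ε π)⁻¹ = similitudeSignedPermEquiv (fun j => ε (π.symm j)) π.symm := by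
  refine inv_eq_of_mul_eq_one_right ?_
  rw [similitudeSignedPermEquiv_mul, ← similitudeSignedPermEquiv_one (n := n)]
  have hπ : π.symm * π = 1 := Equiv.ext fun i => by simp
  rw [hπ]
  congr 1
  funext i
  rw [Equiv.symm_apply_apply, Int.units_mul_self]

/-- The elements `(ε, π)` form a subgroup of `Aut_ℤ(ℤⁿ × ℤ)` (as a set: the range of `similitudeSignedPermEquiv`).
[cite: AndrianovZhuravlev1995, Ch. 3 §3.3 (3.51)] -/
def similitudeSignedPermSubgroup (n : ℕ) : Subgroup (((Fin n → ℤ) × ℤ) ≃ₗ[ℤ] ((Fin n → ℤ) × ℤ)) where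
  carrier := Set.range fun p : (Fin n → ℤˣ) × Equiv.Perm (Fin n) => similitudeSignedPermEquiv p.1 p.2
  mul_mem' := by
    rintro _ _ ⟨⟨ε, π⟩, rfl⟩ ⟨⟨ε', π'⟩, rfl⟩
    exact ⟨(fun i => ε i * ε' (π i), π' * π), (similitudeSignedPermEquiv_mul ε ε' π π').symm⟩
  one_mem' := ⟨(fun _ => 1, 1), similitudeSignedPermEquiv_one⟩
  inv_mem' := by
    rintro _ ⟨⟨ε, π⟩, rfl⟩
    exact ⟨(fun j => ε (π.symm j), π.symm), (similitudeSignedPermEquiv_inv ε π).symm⟩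

/-- **`W(GSp_{2n})` consists exactly of the `(ε, π)`.** [cite: AndrianovZhuravlev1995, Ch. 3 §3.3 (3.51)] [cite: Satake1963, §7] -/
theorem mem_similitudeWeylGroup_iff (w : ((Fin n → ℤ) × ℤ) ≃ₗ[ℤ] ((Fin n → ℤ) × ℤ)) :
    w ∈ similitudeWeylGroup n ↔ ∃ (ε : Fin n → ℤˣ) (π : Equiv.Perm (Fin n)), w = similitudeSignedPermEquiv ε π := by
  constructor
  · intro hw
    have hle : similitudeWeylGroup n ≤ similitudeSignedPermSubgroup n := by
      unfold similitudeWeylGroup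
      rw [Subgroup.closure_le]
      rintro _ ⟨p, rfl⟩
      exact ⟨p, rfl⟩
    obtain ⟨⟨ε, π⟩, h⟩ := hle hw
    exact ⟨ε, π, h.symm⟩
  · rintro ⟨ε, π, rfl⟩
    exact similitudeSignedPermEquiv_mem_similitudeWeylGroup ε π

/-- **`W(GSp_{2n})` is finite** (of order `2^n n!`). [cite: AndrianovZhuravlev1995, Ch. 3 §3.3 (3.51)] -/
theorem finite_similitudeWeylGroup : Finite (similitudeWeylGroup n) := by
  have h : (similitudeWeylGroup n : Set (((Fin n → ℤ) × ℤ) ≃ₗ[ℤ] ((Fin n → ℤ) × ℤ))) =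
      Set.range (fun p : (Fin n → ℤˣ) × Equiv.Perm (Fin n) => similitudeSignedPermEquiv p.1 p.2) := by
    ext w
    rw [SetLike.mem_coe, mem_similitudeWeylGroup_iff, Set.mem_range]
    constructor
    · rintro ⟨ε, π, rfl⟩; exact ⟨(ε, π), rfl⟩
    · rintro ⟨p, rfl⟩; exact ⟨p.1, p.2, rfl⟩
  have hfin : (similitudeWeylGroup n : Set (((Fin n → ℤ) × ℤ) ≃ₗ[ℤ] ((Fin n → ℤ) × ℤ))).Finite := by
    rw [h]; exact Set.finite_range _
  exact hfin.to_subtype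

/-! ## §2 `W(GSp_{2n})` acting on `k[ℤⁿ × ℤ]` by algebra automorphisms -/

section Action

variable (n) (k : Type*) [CommRing k]

/-- **`W(GSp_{2n}) → Aut_{k-alg}(k[ℤⁿ × ℤ])`**, `w ↦ (x^λ ↦ x^{w λ})`. [cite: CartierCorvallis1979, §IV Cor. 4.2] -/
def similitudeWeylGroupAlgAut :
    similitudeWeylGroup n →* (AddMonoidAlgebra k ((Fin n → ℤ) × ℤ) ≃ₐ[k] AddMonoidAlgebra k ((Fin n → ℤ) × ℤ)) where
  toFun w := AddMonoidAlgebra.domCongr k k (w : ((Fin n → ℤ) × ℤ) ≃ₗ[ℤ] ((Fin n → ℤ) × ℤ)).toAddEquiv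
  map_one' := by
    refine AlgEquiv.ext fun f => AddMonoidAlgebra.ext (Finsupp.ext fun m => ?_)
    rw [AddMonoidAlgebra.coeff_domCongr, AlgEquiv.one_apply]
    rfl
  map_mul' w w' := by
    refine AlgEquiv.ext fun f => AddMonoidAlgebra.ext (Finsupp.ext fun m => ?_)
    rw [AddMonoidAlgebra.coeff_domCongr, AlgEquiv.mul_apply, AddMonoidAlgebra.coeff_domCongr, AddMonoidAlgebra.coeff_domCongr]
    rfl

/-- The `W(GSp_{2n})`-action on `k[ℤⁿ × ℤ]` as a `MulSemiringAction` (a definition, used through `letI`).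
[cite: CartierCorvallis1979, §IV Cor. 4.2] -/
@[reducible] def similitudeWeylGroupAction : MulSemiringAction (similitudeWeylGroup n) (AddMonoidAlgebra k ((Fin n → ℤ) × ℤ)) :=
  MulSemiringAction.compHom _ (similitudeWeylGroupAlgAut n k)

variable {n k}

/-- Under `similitudeWeylGroupAction`, `w • f = domCongr w f`. [cite: CartierCorvallis1979, §IV Cor. 4.2] -/
theorem similitudeWeylGroupAction_smul (w : similitudeWeylGroup n) (f : AddMonoidAlgebra k ((Fin n → ℤ) × ℤ)) :
    (letI := similitudeWeylGroupAction n k; w • f) =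
      AddMonoidAlgebra.domCongr k k (w : ((Fin n → ℤ) × ℤ) ≃ₗ[ℤ] ((Fin n → ℤ) × ℤ)).toAddEquiv f := rfl

/-- **The fixed points of the action are the Weyl invariants `k[ℤⁿ × ℤ]^{W(GSp_{2n})}`.** [cite: CartierCorvallis1979, §IV.2, Cor. 4.2] -/
theorem forall_smul_eq_self_iff_mem_weylInvariants_similitude (f : AddMonoidAlgebra k ((Fin n → ℤ) × ℤ)) :
    (∀ w : similitudeWeylGroup n, (letI := similitudeWeylGroupAction n k; w • f) = f) ↔
      f ∈ weylInvariants k ((Fin n → ℤ) × ℤ) (similitudeWeylGroup n) := by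
  rw [mem_weylInvariants_iff]
  exact ⟨fun h w hw => h ⟨w, hw⟩, fun h w => h w.1 w.2⟩

end Action

/-! ## §3 The characters `ev_χ` of `k[ℤⁿ × ℤ]` and the Satake parameters `(β₀; β_1, …, β_n)` -/

section EvalChar

variable {k : Type*} [CommRing k]

/-- **`ev_χ : k[ℤⁿ × ℤ] →ₐ[k] k`**, evaluation at a character `χ` of `ℤⁿ × ℤ` (`x^λ ↦ χ(λ)`; A–Z: `x_0 ↦ α_0`, `x_i ↦ α_i`).
[cite: AndrianovZhuravlev1995, Ch. 3 §3.3 Prop. 3.36] [cite: CartierCorvallis1979, §IV Cor. 4.2] -/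
def similitudeEvalChar (χ : Multiplicative ((Fin n → ℤ) × ℤ) →* k) : AddMonoidAlgebra k ((Fin n → ℤ) × ℤ) →ₐ[k] k :=
  AddMonoidAlgebra.lift k k ((Fin n → ℤ) × ℤ) χ

/-- `ev_χ(c x^λ) = c χ(λ)`. [cite: CartierCorvallis1979, §IV Cor. 4.2] -/
theorem similitudeEvalChar_single (χ : Multiplicative ((Fin n → ℤ) × ℤ) →* k) (lc : (Fin n → ℤ) × ℤ) (c : k) :
    similitudeEvalChar χ (AddMonoidAlgebra.single lc c) = c * χ (Multiplicative.ofAdd lc) := by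
  rw [similitudeEvalChar, AddMonoidAlgebra.lift_single, smul_eq_mul]

/-- `ev_χ(w • x^λ) = χ(w λ)`. [cite: CartierCorvallis1979, §IV Cor. 4.2] -/
theorem similitudeEvalChar_smul_single_one (χ : Multiplicative ((Fin n → ℤ) × ℤ) →* k) (w : similitudeWeylGroup n)
    (lc : (Fin n → ℤ) × ℤ) :
    similitudeEvalChar χ (letI := similitudeWeylGroupAction n k; w • AddMonoidAlgebra.single lc (1 : k)) =
      χ (Multiplicative.ofAdd ((w : ((Fin n → ℤ) × ℤ) ≃ₗ[ℤ] ((Fin n → ℤ) × ℤ)) lc)) := by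
  rw [similitudeWeylGroupAction_smul, AddMonoidAlgebra.domCongr_single, similitudeEvalChar_single, one_mul]
  rfl

/-- **Satake parameters**: a character `χ` of `ℤⁿ × ℤ` is `(μ, c) ↦ β₀^c ∏ βᵢ^{μᵢ}` with `β₀ = χ(0, 1)`, `βᵢ = χ(eᵢ, 0)` — A–Z's
`(α_0, α_1, …, α_n) ∈ (ℂ^*)^{n+1}`. [cite: AndrianovZhuravlev1995, Ch. 3 §3.3 Prop. 3.36] [cite: GrossSatake1998, §6] -/
theorem map_ofAdd_eq_coe_prod_toHomUnits_similitude (χ : Multiplicative ((Fin n → ℤ) × ℤ) →* k) (μ : Fin n → ℤ) (c : ℤ) :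
    χ (Multiplicative.ofAdd (μ, c)) =
      ((χ.toHomUnits (Multiplicative.ofAdd ((0 : Fin n → ℤ), (1 : ℤ))) ^ c *
        ∏ i, χ.toHomUnits (Multiplicative.ofAdd ((Pi.single i (1 : ℤ) : Fin n → ℤ), (0 : ℤ))) ^ μ i : kˣ) : k) := by
  have hsplit : ((μ, c) : (Fin n → ℤ) × ℤ) = ((0 : Fin n → ℤ), c) + (μ, 0) := by
    refine Prod.ext ?_ ?_ <;> simp
  rw [hsplit, ofAdd_add, map_mul, Units.val_mul]
  congr 1
  · rw [← MonoidHom.coe_toHomUnits, ← map_zpow, ← ofAdd_zsmul]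
    congr 3
    refine Prod.ext ?_ ?_ <;> simp
  · have h := map_ofAdd_eq_coe_prod_toHomUnits (χ.comp (AddMonoidHom.toMultiplicative (AddMonoidHom.inl (Fin n → ℤ) ℤ))) μ
    have e1 : (χ.comp (AddMonoidHom.toMultiplicative (AddMonoidHom.inl (Fin n → ℤ) ℤ))) (Multiplicative.ofAdd μ) =
        χ (Multiplicative.ofAdd (μ, (0 : ℤ))) := rfl
    have e2 : ∀ i, (χ.comp (AddMonoidHom.toMultiplicative (AddMonoidHom.inl (Fin n → ℤ) ℤ))).toHomUnits
        (Multiplicative.ofAdd (Pi.single i (1 : ℤ))) = χ.toHomUnits (Multiplicative.ofAdd ((Pi.single i (1 : ℤ) : Fin n → ℤ), (0 : ℤ))) :=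
      fun i => Units.ext rfl
    rw [e1] at h
    rw [h]
    exact congrArg Units.val (Finset.prod_congr rfl fun i _ => by rw [e2])

variable {K : Type*} [Field K] [Valued K ℤᵐ⁰] {ϖ : K} [NeZero n]

/-- `λ_χ(T) = ev_χ(𝒮_q T)`. [cite: AndrianovZhuravlev1995, Ch. 3 §3.3 Prop. 3.36] [cite: CartierCorvallis1979, §IV (4.2), Cor. 4.2] -/
theorem similitudeHeckeEigencharacter_apply_eq_similitudeEvalChar (hϖ : Valued.v ϖ = WithZero.exp (-1 : ℤ)) (q : kˣ)
    (χ : Multiplicative ((Fin n → ℤ) × ℤ) →* k)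
    (T : heckeAlgebra k (symplecticSimilitudeGroup (Fin n) K) (symplecticSimilitudeInt (Fin n) K)) :
    similitudeHeckeEigencharacter hϖ q χ T = similitudeEvalChar χ (similitudeSatakeTransform hϖ q T) := rfl

end EvalChar

/-! ## §4 Existence: every character of `ℋ_k(GSp_{2n}(K), GSp_{2n}(𝒪))` is a `λ_χ` (A–Z Prop. 3.36) -/

section Existence

variable {k : Type*} [Field k] [IsAlgClosed k] {K : Type*} [Field K] [Valued K ℤᵐ⁰] {ϖ : K} [NeZero n] [CompactSpace 𝒪[K]]
  [Finite 𝓀[K]]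
  [IsHeckeTriple (⊤ : Submonoid (symplecticSimilitudeGroup (Fin n) K)) (symplecticSimilitudeInt (Fin n) K)
    (symplecticSimilitudeInt (Fin n) K)]

/-- **ANDRIANOV–ZHURAVLEV PROP. 3.36 / CARTIER COR. 4.2 (EXISTENCE) FOR `GSp_{2n}` IN EVERY RANK**: over an algebraically closed
field `k` with `(q : k) = #𝓀` a unit, every `k`-algebra homomorphism `ψ : ℋ_k(GSp_{2n}(K), GSp_{2n}(𝒪)) → k` is an unramified Hecke
eigencharacter `λ_χ = ev_χ ∘ 𝒮_q` for some character `χ` of `ℤⁿ × ℤ` («every nonzero ℚ-linear homomorphism `λ : L^n_p → ℂ` has the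
form `λ = λ_A`»). [cite: AndrianovZhuravlev1995, Ch. 3 §3.3 Prop. 3.36] [cite: CartierCorvallis1979, §IV Cor. 4.2] [cite: Satake1963, §7] -/
theorem exists_eq_similitudeHeckeEigencharacter (hϖ : Valued.v ϖ = WithZero.exp (-1 : ℤ)) (q : kˣ) (hq : (q : k) = Nat.card 𝓀[K])
    (ψ : heckeAlgebra k (symplecticSimilitudeGroup (Fin n) K) (symplecticSimilitudeInt (Fin n) K) →ₐ[k] k) :
    ∃ χ : Multiplicative ((Fin n → ℤ) × ℤ) →* k, ψ = similitudeHeckeEigencharacter hϖ q χ := by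
  classical
  letI := similitudeWeylGroupAction n k
  haveI := finite_similitudeWeylGroup (n := n)
  set A : Subalgebra k (AddMonoidAlgebra k ((Fin n → ℤ) × ℤ)) := weylInvariants k ((Fin n → ℤ) × ℤ) (similitudeWeylGroup n)
    with hAdef
  have hA : ∀ b : AddMonoidAlgebra k ((Fin n → ℤ) × ℤ), (∀ g : similitudeWeylGroup n, g • b = b) → b ∈ A := fun b hb =>
    (forall_smul_eq_self_iff_mem_weylInvariants_similitude b).1 hb
  set φ : A →ₐ[k] k := ψ.comp (similitudeSatakeAlgEquiv hϖ q hq).symm.toAlgHom with hφ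
  obtain ⟨Ψ, hΨ⟩ := exists_algHom_extend_of_fixedPoints A hA φ
  set χ : Multiplicative ((Fin n → ℤ) × ℤ) →* k := (AddMonoidAlgebra.lift k k ((Fin n → ℤ) × ℤ)).symm Ψ with hχ
  have hΨχ : Ψ = similitudeEvalChar χ := by rw [similitudeEvalChar, hχ, Equiv.apply_symm_apply]
  refine ⟨χ, AlgHom.ext fun T => ?_⟩
  have hmem := similitudeSatakeTransform_mem_weylInvariants hϖ q hq T
  have h1 : ψ T = φ ⟨similitudeSatakeTransform hϖ q T, hmem⟩ := by
    change ψ T = ψ ((similitudeSatakeAlgEquiv hϖ q hq).symm ⟨similitudeSatakeTransform hϖ q T, hmem⟩)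
    rw [similitudeSatakeAlgEquiv_symm_apply_similitudeSatakeTransform]
  rw [h1, ← hΨ ⟨_, hmem⟩, similitudeHeckeEigencharacter_apply_eq_similitudeEvalChar, hΨχ]

/-- The same with the parameter as a point `(β₀; β) ∈ kˣ × (kˣ)ⁿ`: `χ(μ, c) = β₀^c ∏ βᵢ^{μᵢ}` — A–Z's `λ = λ_A`,
`A = (α_0, …, α_n) ∈ (k^*)^{n+1}`. [cite: AndrianovZhuravlev1995, Ch. 3 §3.3 Prop. 3.36] [cite: GrossSatake1998, §6] -/
theorem exists_eq_similitudeHeckeEigencharacter_point (hϖ : Valued.v ϖ = WithZero.exp (-1 : ℤ)) (q : kˣ)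
    (hq : (q : k) = Nat.card 𝓀[K])
    (ψ : heckeAlgebra k (symplecticSimilitudeGroup (Fin n) K) (symplecticSimilitudeInt (Fin n) K) →ₐ[k] k) :
    ∃ (β₀ : kˣ) (β : Fin n → kˣ) (χ : Multiplicative ((Fin n → ℤ) × ℤ) →* k),
      (∀ (μ : Fin n → ℤ) (c : ℤ), χ (Multiplicative.ofAdd (μ, c)) = ((β₀ ^ c * ∏ i, β i ^ μ i : kˣ) : k)) ∧
        ψ = similitudeHeckeEigencharacter hϖ q χ := by
  obtain ⟨χ, hχ⟩ := exists_eq_similitudeHeckeEigencharacter hϖ q hq ψ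
  exact ⟨χ.toHomUnits (Multiplicative.ofAdd ((0 : Fin n → ℤ), (1 : ℤ))),
    fun i => χ.toHomUnits (Multiplicative.ofAdd ((Pi.single i (1 : ℤ) : Fin n → ℤ), (0 : ℤ))), χ,
    fun μ c => map_ofAdd_eq_coe_prod_toHomUnits_similitude χ μ c, hχ⟩

end Existence

/-! ## §5 Uniqueness up to `W(GSp_{2n})` (A–Z Problem 3.41: `λ_A = λ_{A'} ↔ A' = wA`) -/

section Invariance

variable {k : Type*} [CommRing k] {K : Type*} [Field K] [Valued K ℤᵐ⁰] {ϖ : K} [NeZero n] [CompactSpace 𝒪[K]] [Finite 𝓀[K]]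
  [IsHeckeTriple (⊤ : Submonoid (symplecticSimilitudeGroup (Fin n) K)) (symplecticSimilitudeInt (Fin n) K)
    (symplecticSimilitudeInt (Fin n) K)]

/-- **(⇐) `W`-conjugate parameters give the same eigencharacter**: if `χ'(λ) = χ(w λ)` for some `w = (ε, π) ∈ W(GSp_{2n})` then
`λ_{χ'} = λ_χ` (the coefficients of `𝒮_q(T)` are `W`-invariant; any commutative `k`). [cite: AndrianovZhuravlev1995, Ch. 3 §3.3 Prop. 3.36, Problem 3.41]
[cite: CartierCorvallis1979, §IV Cor. 4.2] -/
theorem similitudeHeckeEigencharacter_eq_of_exists_signedPerm (hϖ : Valued.v ϖ = WithZero.exp (-1 : ℤ)) (q : kˣ)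
    (hq : (q : k) = Nat.card 𝓀[K]) {χ χ' : Multiplicative ((Fin n → ℤ) × ℤ) →* k} (ε : Fin n → ℤˣ) (π : Equiv.Perm (Fin n))
    (h : ∀ lc : (Fin n → ℤ) × ℤ, χ' (Multiplicative.ofAdd lc) = χ (Multiplicative.ofAdd (similitudeSignedPermEquiv ε π lc))) :
    similitudeHeckeEigencharacter hϖ q χ' = similitudeHeckeEigencharacter hϖ q χ := by
  refine AlgHom.ext fun T => ?_
  rw [similitudeHeckeEigencharacter_apply_eq_similitudeEvalChar, similitudeHeckeEigencharacter_apply_eq_similitudeEvalChar]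
  have hχ' : χ' = χ.comp (AddMonoidHom.toMultiplicative (similitudeSignedPermEquiv ε π).toAddEquiv.toAddMonoidHom) := by
    refine MonoidHom.ext fun m => ?_
    have hm : m = Multiplicative.ofAdd (Multiplicative.toAdd m) := rfl
    rw [hm, h, MonoidHom.comp_apply]
    rfl
  have hfix := (mem_weylInvariants_iff _).1 (similitudeSatakeTransform_mem_weylInvariants hϖ q hq T) _
    (similitudeSignedPermEquiv_mem_similitudeWeylGroup ε π)
  rw [similitudeEvalChar, similitudeEvalChar, hχ', lift_comp_toMultiplicative_eq_lift_domCongr]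
  exact congrArg _ hfix

end Invariance

section Unique

variable {k : Type*} [Field k] {K : Type*} [Field K] [Valued K ℤᵐ⁰] {ϖ : K} [NeZero n] [CompactSpace 𝒪[K]] [Finite 𝓀[K]]
  [IsHeckeTriple (⊤ : Submonoid (symplecticSimilitudeGroup (Fin n) K)) (symplecticSimilitudeInt (Fin n) K)
    (symplecticSimilitudeInt (Fin n) K)]

/-- **(⇒) Equal eigencharacters have `W(GSp_{2n})`-conjugate parameters**: if `λ_{χ'} = λ_χ` then `χ'(λ) = χ(w λ)` for some
`w = (ε, π)` (transitivity of the finite group `W` on the maximal ideals of `k[ℤⁿ × ℤ]` over a maximal ideal of `k[ℤⁿ × ℤ]^W`;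
any field `k`). [cite: AndrianovZhuravlev1995, Ch. 3 §3.3 Problem 3.41] [cite: CartierCorvallis1979, §IV Cor. 4.2]
[cite: BourbakiAC5to7, Ch. V §2 no. 2 Thm. 2] -/
theorem exists_signedPerm_of_similitudeHeckeEigencharacter_eq (hϖ : Valued.v ϖ = WithZero.exp (-1 : ℤ)) (q : kˣ)
    (hq : (q : k) = Nat.card 𝓀[K]) {χ χ' : Multiplicative ((Fin n → ℤ) × ℤ) →* k}
    (h : similitudeHeckeEigencharacter (K := K) (n := n) hϖ q χ' = similitudeHeckeEigencharacter hϖ q χ) :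
    ∃ (ε : Fin n → ℤˣ) (π : Equiv.Perm (Fin n)),
      ∀ lc : (Fin n → ℤ) × ℤ, χ' (Multiplicative.ofAdd lc) = χ (Multiplicative.ofAdd (similitudeSignedPermEquiv ε π lc)) := by
  classical
  letI := similitudeWeylGroupAction n k
  haveI := finite_similitudeWeylGroup (n := n)
  set A : Subalgebra k (AddMonoidAlgebra k ((Fin n → ℤ) × ℤ)) := weylInvariants k ((Fin n → ℤ) × ℤ) (similitudeWeylGroup n)
    with hAdef
  have hAfix : ∀ b : AddMonoidAlgebra k ((Fin n → ℤ) × ℤ), b ∈ A ↔ ∀ g : similitudeWeylGroup n, g • b = b := fun b =>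
    (forall_smul_eq_self_iff_mem_weylInvariants_similitude b).symm
  haveI : Algebra.IsInvariant A (AddMonoidAlgebra k ((Fin n → ℤ) × ℤ)) (similitudeWeylGroup n) :=
    ⟨fun b hb => ⟨⟨b, (hAfix b).2 hb⟩, rfl⟩⟩
  haveI : SMulCommClass (similitudeWeylGroup n) A (AddMonoidAlgebra k ((Fin n → ℤ) × ℤ)) :=
    ⟨fun g a b => by
      rw [Algebra.smul_def, Algebra.smul_def, smul_mul']
      show g • (a : AddMonoidAlgebra k ((Fin n → ℤ) × ℤ)) * g • b = (a : AddMonoidAlgebra k ((Fin n → ℤ) × ℤ)) * g • b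
      rw [(hAfix a.1).1 a.2 g]⟩
  have hagree : ∀ a : A, similitudeEvalChar χ' (a : AddMonoidAlgebra k ((Fin n → ℤ) × ℤ)) = similitudeEvalChar χ a := fun a => by
    obtain ⟨T, hT⟩ := exists_similitudeSatakeTransform_eq hϖ q hq a.1 a.2
    rw [← hT, ← similitudeHeckeEigencharacter_apply_eq_similitudeEvalChar, ← similitudeHeckeEigencharacter_apply_eq_similitudeEvalChar, h]
  have hsurj : ∀ γ : Multiplicative ((Fin n → ℤ) × ℤ) →* k, Function.Surjective (similitudeEvalChar (n := n) γ) := fun γ c =>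
    ⟨algebraMap k _ c, AlgHom.commutes _ c⟩
  haveI hM : (RingHom.ker (similitudeEvalChar χ)).IsMaximal := RingHom.ker_isMaximal_of_surjective _ (hsurj χ)
  haveI hM' : (RingHom.ker (similitudeEvalChar χ')).IsMaximal := RingHom.ker_isMaximal_of_surjective _ (hsurj χ')
  have hunder : (RingHom.ker (similitudeEvalChar χ)).under A = (RingHom.ker (similitudeEvalChar χ')).under A := by
    refine Ideal.ext fun a => ?_
    change a ∈ (RingHom.ker (similitudeEvalChar χ)).comap (algebraMap A _) ↔ a ∈ (RingHom.ker (similitudeEvalChar χ')).comap (algebraMap A _)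
    rw [Ideal.mem_comap, Ideal.mem_comap, RingHom.mem_ker, RingHom.mem_ker]
    show similitudeEvalChar χ (a : AddMonoidAlgebra k ((Fin n → ℤ) × ℤ)) = 0 ↔
      similitudeEvalChar χ' (a : AddMonoidAlgebra k ((Fin n → ℤ) × ℤ)) = 0
    rw [hagree]
  obtain ⟨g, hg⟩ := Algebra.IsInvariant.exists_smul_of_under_eq (A := A) (B := AddMonoidAlgebra k ((Fin n → ℤ) × ℤ))
    (G := similitudeWeylGroup n) (P := RingHom.ker (similitudeEvalChar χ)) (Q := RingHom.ker (similitudeEvalChar χ')) hunder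
  set Φ : AddMonoidAlgebra k ((Fin n → ℤ) × ℤ) →ₐ[k] k :=
    (similitudeEvalChar χ).comp (similitudeWeylGroupAlgAut n k g⁻¹ : _ ≃ₐ[k] _).toAlgHom with hΦ
  have hΦapply : ∀ b, Φ b = similitudeEvalChar χ (g⁻¹ • b) := fun b => rfl
  have hker : RingHom.ker Φ ≤ RingHom.ker (similitudeEvalChar χ') := fun b hb => by
    rw [RingHom.mem_ker] at hb ⊢
    have h1 : g⁻¹ • b ∈ RingHom.ker (similitudeEvalChar χ) := by rw [RingHom.mem_ker]; exact hb
    have h2 : b ∈ g • RingHom.ker (similitudeEvalChar χ) := Ideal.mem_pointwise_smul_iff_inv_smul_mem.2 h1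
    rw [← hg, RingHom.mem_ker] at h2
    exact h2
  have heq : similitudeEvalChar χ' = Φ := algHom_eq_of_ker_le Φ (similitudeEvalChar χ') hker
  obtain ⟨ε, π, hgw⟩ := (mem_similitudeWeylGroup_iff _).1 (g⁻¹).2
  refine ⟨ε, π, fun lc => ?_⟩
  have h1 : similitudeEvalChar χ' (AddMonoidAlgebra.single lc 1) = Φ (AddMonoidAlgebra.single lc 1) := by rw [heq]
  rw [hΦapply, similitudeEvalChar_smul_single_one, similitudeEvalChar_single, one_mul] at h1
  rw [h1]
  change χ (Multiplicative.ofAdd (((g⁻¹ : similitudeWeylGroup n) : ((Fin n → ℤ) × ℤ) ≃ₗ[ℤ] ((Fin n → ℤ) × ℤ)) lc)) = _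
  rw [hgw]

/-- **A–Z PROBLEM 3.41 / CARTIER COR. 4.2 FOR `GSp_{2n}`, UNIQUENESS UP TO `W(GSp_{2n})`, EVERY RANK**: `λ_{χ'} = λ_χ` iff
`χ' = χ ∘ w` for some `w ∈ W(GSp_{2n})`.  With `exists_eq_similitudeHeckeEigencharacter`:
`Hom_{k-alg}(ℋ_k(GSp_{2n}(K), GSp_{2n}(𝒪)), k) ≅ Hom(ℤⁿ × ℤ, kˣ)/W = (kˣ × (kˣ)ⁿ)/W(GSp_{2n})` (`k` algebraically closed for the
surjection, `(q : k) = #𝓀 ∈ kˣ`; injectivity over every field). [cite: AndrianovZhuravlev1995, Ch. 3 §3.3 Prop. 3.36, Problem 3.41]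
[cite: CartierCorvallis1979, §IV Cor. 4.2] [cite: Satake1963, §7] -/
theorem similitudeHeckeEigencharacter_eq_iff_exists_signedPerm (hϖ : Valued.v ϖ = WithZero.exp (-1 : ℤ)) (q : kˣ)
    (hq : (q : k) = Nat.card 𝓀[K]) (χ χ' : Multiplicative ((Fin n → ℤ) × ℤ) →* k) :
    similitudeHeckeEigencharacter (K := K) (n := n) hϖ q χ' = similitudeHeckeEigencharacter hϖ q χ ↔
      ∃ (ε : Fin n → ℤˣ) (π : Equiv.Perm (Fin n)),
        ∀ lc : (Fin n → ℤ) × ℤ, χ' (Multiplicative.ofAdd lc) = χ (Multiplicative.ofAdd (similitudeSignedPermEquiv ε π lc)) :=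
  ⟨exists_signedPerm_of_similitudeHeckeEigencharacter_eq hϖ q hq,
    fun ⟨ε, π, h⟩ => similitudeHeckeEigencharacter_eq_of_exists_signedPerm hϖ q hq ε π h⟩

end Unique

end Literature.NumberTheory.Automorphic.SymplecticCartan

end
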